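import Mathlib

/-!
# k1 GEN 29 sketch — the INDEX SANDWICH behind one-sided ARS (rider N1″), statements only

Abstract lattice algebra (Mathlib only).  `V` a `ℚ`-vector space, `e` an endomorphism (think: the idempotent
`e_f ∈ 𝕋 ⊗ ℚ` of the newform), `M` a `ℤ`-lattice (think: `H₁(X₀(N), ℤ)` or a free `𝕋`-submodule `F` of it).
`splitOf e M = e(M) + (1 - e)(M)` and `congrIndex e M = [splitOf e M : M]`.
Dictionary (XL, typed in k1 g16/g17: `Dict_S`, `Dict_Lambda`, `RankTwo`, `UnimodularityConverse`, `FreyWilesData`):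
`congrIndex e_f 𝕋 = r_f`, `congrIndex e_f (𝕋y₁ ⊕ 𝕋y₂) = r_f²`, `congrIndex e_f H₁(X₀(N),ℤ) = m_E²` (optimal `E`).
The sandwich identity then reads `2·v_p(r_f) ≤ 2·v_p(m_E) + v_p [H : F]` for every free rank-two
`𝕋`-sublattice `F ≤ H` — so `v_p r_f ≤ v_p m_E` as soon as the freeness index is prime to `p`
(multiplicity one + Gorenstein at the maximal ideals over `p`; Wiles 1995 Thm 2.1(ii) for `p ∥ N`, `p ≥ 5`, Frey).
Proofs are deliberately `sorry` (planner: statements only; each is one prover cycle, Mathlib-only).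
-/

set_option linter.dupNamespace false

namespace Summit.ABC.ABC.Cruxes.SteinbergCore.StubIdeasK1G29

variable {V : Type*} [AddCommGroup V] [Module ℚ V]

/-- An endomorphism of the `ℚ`-space as a `ℤ`-linear map. -/
def intEnd (e : Module.End ℚ V) : V →ₗ[ℤ] V := e.toAddMonoidHom.toIntLinearMap

/-- `ẽM := e(M) + (1 - e)(M)`, the smallest lattice containing `e(M)` and `(1-e)(M)` (it contains `M`). -/
def splitOf (e : Module.End ℚ V) (M : Submodule ℤ V) : Submodule ℤ V :=
  M.map (intEnd e) ⊔ M.map (intEnd (1 - e))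

/-- The congruence index `c_e(M) := [ẽM : M]` ("denominator of the idempotent on `M`"; `0` = infinite). -/
noncomputable def congrIndex (e : Module.End ℚ V) (M : Submodule ℤ V) : ℕ :=
  M.toAddSubgroup.relIndex (splitOf e M).toAddSubgroup

/-- S1: `M ≤ ẽM` (because `m = e m + (1 - e) m`). -/
theorem le_splitOf (e : Module.End ℚ V) (M : Submodule ℤ V) : M ≤ splitOf e M := by
  sorry

/-- S2: `ẽ` is monotone. -/
theorem splitOf_mono (e : Module.End ℚ V) {F M : Submodule ℤ V} (h : F ≤ M) :
    splitOf e F ≤ splitOf e M := by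
  sorry

/-- S3: finite index is inherited by the split lattices: `[M : F] = d ≠ 0 ⇒ d • ẽM ≤ ẽF`, and `ẽM` is
finitely generated, so `[ẽM : ẽF] ≠ 0`. -/
theorem relIndex_splitOf_ne_zero (e : Module.End ℚ V) {F M : Submodule ℤ V} (h : F ≤ M) (hM : M.FG)
    (hi : F.toAddSubgroup.relIndex M.toAddSubgroup ≠ 0) :
    (splitOf e F).toAddSubgroup.relIndex (splitOf e M).toAddSubgroup ≠ 0 := by
  sorry

/-- S4: the congruence index of a finitely generated FULL lattice is finite (`e(M) ⊆ d⁻¹ M`; fullness is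
needed: `M = ℤ(1,0) ⊂ ℚ²` with `e` the projection onto the diagonal has `[ẽM : M] = ∞`). -/
theorem congrIndex_ne_zero (e : Module.End ℚ V) {M : Submodule ℤ V} (hM : M.FG)
    (hMV : Submodule.span ℚ (M : Set V) = ⊤) : congrIndex e M ≠ 0 := by
  sorry

/-- **S5 — the sandwich identity**: `c(F) · [ẽM : ẽF] = c(M) · [M : F]` for `F ≤ M`
(both sides are `[ẽM : F]`, by `AddSubgroup.relIndex_mul_relindex` along `F ≤ M ≤ ẽM` and `F ≤ ẽF ≤ ẽM`). -/
theorem congrIndex_mul_relIndex_splitOf (e : Module.End ℚ V) {F M : Submodule ℤ V} (h : F ≤ M) :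
    congrIndex e F * (splitOf e F).toAddSubgroup.relIndex (splitOf e M).toAddSubgroup =
      congrIndex e M * F.toAddSubgroup.relIndex M.toAddSubgroup := by
  sorry

/-- **S6 — valuation corollary** (the form the ARS dictionary consumes):
`v_p c(F) ≤ v_p c(M) + v_p [M : F]`.  With `c(F) = r_f²`, `c(H) = m_E²`:
`2 v_p r_f ≤ 2 v_p m_E + v_p [H : F]`. -/
theorem padicValNat_congrIndex_le (e : Module.End ℚ V) {F M : Submodule ℤ V} (h : F ≤ M) (hM : M.FG)
    (hMV : Submodule.span ℚ (M : Set V) = ⊤) (hi : F.toAddSubgroup.relIndex M.toAddSubgroup ≠ 0)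
    (p : ℕ) [Fact p.Prime] :
    padicValNat p (congrIndex e F) ≤
      padicValNat p (congrIndex e M) + padicValNat p (F.toAddSubgroup.relIndex M.toAddSubgroup) := by
  sorry

/-- S7 (numerical form of one-sided ARS, pure arithmetic): from `2a ≤ 2b + i` with `i` the `p`-adic
valuation of a freeness index PRIME TO `p` (`i = 0`) we get `a ≤ b`. -/
theorem le_of_two_mul_le_add {a b i : ℕ} (h : 2 * a ≤ 2 * b + i) (hi : i = 0) : a ≤ b := by
  omega

end Summit.ABC.ABC.Cruxes.SteinbergCore.StubIdeasK1G29
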